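import Literature.Geometry.Kaehler.ComplexTorusIntegralHodgeLatticeLefschetzPiecesDiscriminant
import Literature.Topology.FourManifolds.LatticeFormsPrimitiveSublatticeDiscriminant
import Literature.Topology.FourManifolds.LatticeFormsRealSignature
import HarnessLib

/-!
# The SIGN of the discriminant of the integral Hodge lattice `Hdgᵖ(X, ℤ)` and of its Lefschetz pieces:
# `sign disc_B(Lˢ Hdgⁱ(X, ℤ)_prim) = ((−1)ⁱ s')^{ρ_pr^{(i)}}`, `sign disc_B Hdgᵖ(X, ℤ) = (s')^{rk} · (−1)^{Σ_{i ≤ p, i odd} ρ_pr^{(i)}}`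

Layer `Literature/Geometry/Kaehler`, namespace `Literature.Geometry.Kaehler.ComplexTorus`; lane `lit-hodgefound`
(Track 2 foundations library), seat p09, generation 48, row g48-#1. THEOREMS ONLY (0 definitions); no named fact, net debt 0.
For a polarised abelian variety `X` of dimension `g = j + 2` and type `(d₁, …, d_g)`, an even degree `k = p + p` with `k + q = g`, the
integral Lefschetz form `B = B_k = ⟨·, γ_q ∧ ·⟩_e` on `Hᵏ(X, ℤ)` (`q!·d₁⋯d_q·γ_q = θ^{∧q}`), `s' = sign(e)·(−1)^q`, the Hodge lattice
`Hdgᵖ(X, ℤ) = Hᵏ(X, ℤ) ∩ H^{p,p}` and its Lefschetz pieces `N_s = Lˢ Hdg^{p−s}(X, ℤ)_prim` (g47-#3), the tree knows the SIGNATURES over `ℤ`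
(g46-#1 `ComplexTorusIntegralHodgeLatticeSignatureClosedForm`: `(b⁺, b⁻)(s'·B∣Hdgᵖ(X, ℤ)) = (Σ_{i ≤ p even} ρ_pr^{(i)}, Σ_{i ≤ p odd} ρ_pr^{(i)})`;
g47-#3: Hodge–Riemann `(−1)ⁱ s'·B > 0` on `N_s ∖ 0`, `i = p − s`) and the DISCRIMINANT RELATION `∏_s disc N_s = I_p² · disc Hdgᵖ(X, ℤ)` (g47-#5).
This file reads off the SIGNS of all these discriminants (Huybrechts' "`sign disc Λ = (−1)^{n₋}`", (0.3)):

* §0 LATTICE GENERALITIES over `ℤ` (any finitely generated lattice `L`, any `ℤ`-basis): **`(−1)^{b⁻(Q)} · det G_b(Q) > 0`** for a symmetric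
  non-degenerate form in ANY basis `b` (`neg_one_pow_sigNeg_mul_det_toMatrix_pos_of_isSymm`; the tree had it for `ℤ^κ` with its standard basis
  and over `ℝ`); **`det G_b(Q) > 0` for `Q` positive definite** (`det_toMatrix_pos_of_posDef`) and `c^{rk} · det G_b(Q) > 0` when `c·Q` is positive
  definite (`pow_mul_det_toMatrix_pos_of_posDef_smul`); **the Gram determinant does not depend on the `ℤ`-basis** (`det_toMatrix_eq_det_toMatrix`,
  change of basis of determinant `±1`).
* §1 THE PIECES: **`(−1)ⁱ s' · B∣N` is POSITIVE DEFINITE on `N = Lˢ Hdgⁱ(X, ℤ)_prim`** (`IsPolarizationType.posDef_smul_restrict_lefschetzPiece`) hence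
  **`((−1)ⁱ s')^{rk N} · disc_B(N) > 0`** in every basis (`IsPolarizationType.pow_mul_det_restrict_lefschetzPiece_pos`, family form
  `….pow_mul_det_restrict_lefschetzPieces_pos`): the discriminant of the `s`-th Lefschetz piece has the sign `((−1)^{p−s} s')^{ρ_pr^{(p−s)}}`.
* §2 THE HODGE LATTICE, in the currency of g46-#1 (`Hdgᵖ(X, ℤ)` as a sublattice of `Hᵏ(X, ℤ)`, form `B∣Hdgᵖ`):
  **`(s')^{rk} · (−1)^{Σ_{i ≤ p, i odd} ρ_pr^{(i)}} · disc_B Hdgᵖ(X, ℤ) > 0`** in every `ℤ`-basis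
  (`IsPolarizationType.pow_mul_neg_one_pow_mul_det_restrict_integralHodgeClassesIn_pos`) — §0 applied to g46-#1's `b⁻`.
* §3 THE HODGE LATTICE, in the currency of g47-#5 (`Hdgᵖ(X, ℤ) = integralHodgeClassesIn Φ k p` with the pulled-back form `B ∘ (ι × ι)`), by a
  SECOND, independent route — the integral Lefschetz decomposition: `∏_s disc N_s = I_p² · disc Hdgᵖ` (g47-#5) and §1 give
  **`(s')^{rk} · (−1)^{Σ_s (p−s)·rk N_s} · disc Hdgᵖ(X, ℤ) > 0`** in every `ℤ`-basis
  (`IsPolarizationType.pow_mul_neg_one_pow_mul_det_comp_inclusion_pos_of_basis_sigma`, `…_pos`).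
* §4 The two exponents agree: `Σ_s (p−s)·rk N_s = Σ_{i ≤ p} i·ρ_pr^{(i)} ≡ Σ_{i ≤ p, i odd} ρ_pr^{(i)} (mod 2)`
  (`IsPolarizationType.neg_one_pow_sum_lefschetzPieces_eq`), so that §3 reads exactly like §2
  (`IsPolarizationType.pow_mul_neg_one_pow_sum_filter_odd_mul_det_comp_inclusion_pos`).

## References

* [cite: Huybrechts2016K3, Ch. 14 §0.1 (signature, discriminant, (0.1)), §0.2 (0.3)]
* [cite: Serre1973, Ch. IV §2.4; Ch. V §1.3.2]
* [cite: VoisinHodgeI2002, §6.3.2 Lemma 6.31, Thm. 6.32 and (6.12) (PDF pp. 128–129); §6.2.3 Rem. 6.27 (PDF p. 126); §7.1.2 (PDF p. 134)]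
* [cite: Lange2023AbelianVarietiesComplex, §5.4.1 Thm. 5.4.2 and (5.22)–(5.23) (PDF p. 275); §7.3.2 (3)]
* [cite: Kitaoka1993, Ch. 5 §5.3 Prop. 5.3.3 (proof)]
* [cite: Ebeling1994, §1.1 ("`Ã = QAQᵗ`")]
-/

noncomputable section

-- `Module ℂ` / `SMulZeroClass ℂ` synthesis on `E [⋀^Fin k]→L[ℝ] ℂ` (as in `ComplexTorusLefschetzDecomposition`)
set_option maxSynthPendingDepth 3

open Module Function Complex
open LinearMap (BilinForm)
open Literature.LinearAlgebra.Alternating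
open Literature.Analysis.Complex (IsOfTypeAt typeSubmodule)

namespace Literature.Geometry.Kaehler.ComplexTorus

/-! ## §0 Lattice generalities: the sign of a Gram determinant over `ℤ` -/

section Generic

variable {L : Type*} [AddCommGroup L] [Module ℤ L] {κ κ' : Type*} [Fintype κ] [DecidableEq κ] [Fintype κ'] [DecidableEq κ']

/-- `det G_b(c · Q) = c^{rk} · det G_b(Q)`. [folklore] -/
private theorem det_toMatrix_smul₉₁ (b : Basis κ ℤ L) (c : ℤ) (Q : BilinForm ℤ L) :
    (LinearMap.BilinForm.toMatrix b (c • Q)).det = c ^ Fintype.card κ * (LinearMap.BilinForm.toMatrix b Q).det := by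
  rw [(LinearMap.BilinForm.toMatrix b).map_smul, Matrix.det_smul]

/-- **`sign (disc Λ) = (−1)^{b⁻(Λ)}` in ANY `ℤ`-basis**: for a symmetric lattice form `Q` on a finitely generated free `ℤ`-module and any
`ℤ`-basis `b` with `det G_b(Q) ≠ 0` (non-degenerate), `(−1)^{b⁻(Q)} · det (Q(bᵢ, bⱼ)) > 0`, `b⁻ = sigNeg` OVER `ℤ` — read on `Λ ⊗ ℝ` with the same Gram
matrix (Serre: the index of `E` is that of `E ⊗ ℝ`; Sylvester), where "`Λ_ℝ` can be diagonalized with only `1` and `−1` on the diagonal" and a change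
of basis multiplies the determinant by a square. [cite: Huybrechts2016K3, Ch. 14 §0.1 and §0.2 (0.3)] [cite: Serre1973, Ch. IV §2.4; Ch. V §1.3.2] [cite: Ebeling1994, §1.1] -/
theorem neg_one_pow_sigNeg_mul_det_toMatrix_pos_of_isSymm (Q : BilinForm ℤ L) (hQ : Q.IsSymm) (b : Basis κ ℤ L)
    (hdet : (LinearMap.BilinForm.toMatrix b Q).det ≠ 0) :
    0 < (-1 : ℤ) ^ sigNeg Q.toQuadraticMap * (LinearMap.BilinForm.toMatrix b Q).det := by
  set G : Matrix κ κ ℤ := LinearMap.BilinForm.toMatrix b Q with hG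
  have hGs : G.IsSymm := Matrix.IsSymm.ext fun i j ↦ by
    rw [hG, LinearMap.BilinForm.toMatrix_apply, LinearMap.BilinForm.toMatrix_apply]
    exact hQ.eq _ _
  have hQn : ∀ x, (∀ y, Q x y = 0) → x = 0 := fun x hx ↦
    ((LinearMap.BilinForm.nondegenerate_iff_det_ne_zero b).2 hdet).1 x hx
  have hGn : ∀ v, (∀ w, Matrix.toBilin' G v w = 0) → v = 0 := fun v hv ↦
    (LinearMap.BilinForm.nondegenerate_toBilin'_of_det_ne_zero' G hdet).1 v hv
  have hGs' : (Matrix.toBilin' G).IsSymm := Matrix.isSymm_toBilin'_iff_isSymm.2 hGs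
  -- the real form with Gram matrix `G`
  set Gr : Matrix κ κ ℝ := G.map (Int.cast : ℤ → ℝ) with hGr
  have hGram₁ : ∀ i j, Matrix.toBilin' Gr (Pi.basisFun ℝ κ i) (Pi.basisFun ℝ κ j) = ((Q (b i) (b j) : ℤ) : ℝ) := fun i j ↦ by
    rw [Pi.basisFun_apply, Pi.basisFun_apply, Matrix.toBilin'_single, hGr, Matrix.map_apply, hG, LinearMap.BilinForm.toMatrix_apply]
  have hGram₂ : ∀ i j, Matrix.toBilin' Gr (Pi.basisFun ℝ κ i) (Pi.basisFun ℝ κ j) =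
      ((Matrix.toBilin' G (Pi.basisFun ℤ κ i) (Pi.basisFun ℤ κ j) : ℤ) : ℝ) := fun i j ↦ by
    rw [Pi.basisFun_apply, Pi.basisFun_apply, Pi.basisFun_apply, Pi.basisFun_apply, Matrix.toBilin'_single, Matrix.toBilin'_single,
      hGr, Matrix.map_apply]
  have h1 := LinearMap.BilinForm.sigNeg_eq_sigNeg_of_gram_eq Q (Matrix.toBilin' Gr) b (Pi.basisFun ℝ κ) hQ hQn hGram₁
  have h2 := LinearMap.BilinForm.sigNeg_eq_sigNeg_of_gram_eq (Matrix.toBilin' G) (Matrix.toBilin' Gr) (Pi.basisFun ℤ κ) (Pi.basisFun ℝ κ)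
    hGs' hGn hGram₂
  rw [h1, ← h2]
  exact LinearMap.BilinForm.neg_one_pow_sigNeg_mul_det_pos G hGs hdet

/-- **A positive definite lattice has positive discriminant** in every `ℤ`-basis (`b⁻ = 0`, non-degenerate).
[cite: Huybrechts2016K3, Ch. 14 §0.1 and §0.2 (0.3)] [cite: Serre1973, Ch. V §1.3.2] -/
theorem det_toMatrix_pos_of_posDef (Q : BilinForm ℤ L) (hQ : Q.IsSymm) (hP : Q.PosDef) (b : Basis κ ℤ L) :
    0 < (LinearMap.BilinForm.toMatrix b Q).det := by
  haveI : Module.Finite ℤ L := Module.Finite.of_basis b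
  rw [LinearMap.BilinForm.posDef_iff] at hP
  have hnd : Q.Nondegenerate := by
    refine ⟨fun x hx ↦ ?_, fun y hy ↦ ?_⟩
    · by_contra h0
      exact (hP x h0).ne' (hx x)
    · by_contra h0
      exact (hP y h0).ne' (hy y)
  have hdet := (LinearMap.BilinForm.nondegenerate_iff_det_ne_zero b).1 hnd
  have h0 : sigNeg Q.toQuadraticMap = 0 :=
    LinearMap.BilinForm.sigNeg_eq_zero_of_posDef fun x hx ↦ hP x hx
  have h := neg_one_pow_sigNeg_mul_det_toMatrix_pos_of_isSymm Q hQ b hdet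
  rwa [h0, pow_zero, one_mul] at h

/-- **`c^{rk} · disc > 0` when the twist `c · Q` is positive definite** (`c = ±1` in the applications: the sign of a definite lattice's discriminant is
`(±1)^{rk}`). [cite: Huybrechts2016K3, Ch. 14 §0.1, §0.2 (0.3) and §0.3 (iv)] [cite: Serre1973, Ch. V §1.3.2] -/
theorem pow_mul_det_toMatrix_pos_of_posDef_smul (Q : BilinForm ℤ L) (hQ : Q.IsSymm) {c : ℤ} (hP : (c • Q).PosDef) (b : Basis κ ℤ L) :
    0 < c ^ Fintype.card κ * (LinearMap.BilinForm.toMatrix b Q).det := by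
  rw [← det_toMatrix_smul₉₁]
  exact det_toMatrix_pos_of_posDef (c • Q) (hQ.smul c) hP b

/-- **`c^{rk} · (−1)^{b⁻(c·Q)} · disc_b(Q) > 0`**: the sign of the discriminant of a symmetric non-degenerate lattice form `Q` read off from the
negative index of inertia of a non-zero twist `c · Q` (`c = ±1` in the applications, where `b⁻(c·Q)` is the known quantity).
[cite: Huybrechts2016K3, Ch. 14 §0.1, §0.2 (0.3) and §0.3 (iv)] [cite: Serre1973, Ch. V §1.3.2] -/
theorem pow_mul_neg_one_pow_mul_det_toMatrix_pos (Q : BilinForm ℤ L) (hQ : Q.IsSymm) (b : Basis κ ℤ L)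
    (hdet : (LinearMap.BilinForm.toMatrix b Q).det ≠ 0) {c : ℤ} (hc : c ≠ 0) {N : ℕ} (hN : sigNeg (c • Q).toQuadraticMap = N) :
    0 < c ^ Fintype.card κ * (-1) ^ N * (LinearMap.BilinForm.toMatrix b Q).det := by
  have hdet' : (LinearMap.BilinForm.toMatrix b (c • Q)).det ≠ 0 := by
    rw [det_toMatrix_smul₉₁]
    exact mul_ne_zero (pow_ne_zero _ hc) hdet
  have h := neg_one_pow_sigNeg_mul_det_toMatrix_pos_of_isSymm (c • Q) (hQ.smul c) b hdet'
  rw [hN, det_toMatrix_smul₉₁, mul_left_comm, ← mul_assoc] at h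
  exact h

/-- **The Gram determinant of a lattice form does not depend on the `ℤ`-basis**: two bases differ by a matrix of determinant `±1`, whose square is
`1` ("`Ã = QAQᵗ`"; `disc Λ` is well defined). [cite: Huybrechts2016K3, Ch. 14 §0.1 (disc)] [cite: Ebeling1994, §1.1 ("`Ã = QAQᵗ`")] -/
theorem det_toMatrix_eq_det_toMatrix (Q : BilinForm ℤ L) (b : Basis κ ℤ L) (c : Basis κ' ℤ L) :
    (LinearMap.BilinForm.toMatrix b Q).det = (LinearMap.BilinForm.toMatrix c Q).det := by
  haveI : Module.Finite ℤ L := Module.Finite.of_basis b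
  -- reindex `c` by `κ`
  have hcard : Fintype.card κ' = Fintype.card κ := by
    rw [← finrank_eq_card_basis c, finrank_eq_card_basis b]
  let e : κ' ≃ κ := Fintype.equivOfCardEq hcard
  let c' : Basis κ ℤ L := c.reindex e
  have hc' : (LinearMap.BilinForm.toMatrix c' Q).det = (LinearMap.BilinForm.toMatrix c Q).det := by
    have hsub : LinearMap.BilinForm.toMatrix c' Q = (LinearMap.BilinForm.toMatrix c Q).submatrix e.symm e.symm := by
      ext i j
      rw [LinearMap.BilinForm.toMatrix_apply, Matrix.submatrix_apply, LinearMap.BilinForm.toMatrix_apply, Basis.reindex_apply,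
        Basis.reindex_apply]
    rw [hsub, Matrix.det_submatrix_equiv_self]
  rw [← hc', ← LinearMap.BilinForm.toMatrix_mul_basis_toMatrix b c' Q, Matrix.det_mul, Matrix.det_mul, Matrix.det_transpose]
  have hu : IsUnit (b.toMatrix c').det := by
    haveI := Basis.invertibleToMatrix b c'
    exact Matrix.isUnit_det_of_invertible _
  rw [mul_comm ((b.toMatrix c').det) _, mul_assoc, ← sq, Int.isUnit_sq hu, mul_one]

end Generic

/-! ## §1 The Lefschetz pieces: `(−1)ⁱ s' · B` is positive definite on `Lˢ Hdgⁱ(X, ℤ)_prim`; the sign of their discriminants -/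

section Pieces

variable {ι : Type*} [Fintype ι] [DecidableEq ι] {E : Type*} [NormedAddCommGroup E] [NormedSpace ℂ E]
  {Φ : (ι → ℝ) ≃L[ℝ] E} {j n k q p : ℕ} {η : E [⋀^Fin 2]→L[ℝ] ℝ} {d : Fin (j + 2) → ℕ}

/-- **`(−1)ⁱ · s' · B_k` is POSITIVE DEFINITE on the Lefschetz piece `N = Lˢ Hdgⁱ(X, ℤ)_prim ⊆ Hᵏ(X, ℤ)`** (`2s + m = k`, `i + i = m`, `k + q = g`,
`s' = sign·(−1)^q`; `N` given by its membership predicate): Hodge–Riemann over `ℤ` on the piece (g47-#3's pointwise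
`neg_one_pow_mul_apply_self_pos_of_eq_lefschetzPow`) as a statement about the lattice form `((−1)ⁱ s')·B∣N`.
[cite: VoisinHodgeI2002, §6.3.2 Lemma 6.31, Thm. 6.32 and (6.12) (PDF pp. 128–129); §6.2.3 Rem. 6.27] [cite: Lange2023AbelianVarietiesComplex, §5.4.1 Thm. 5.4.2 and (5.22) (PDF p. 275)] -/
theorem IsPolarizationType.posDef_smul_restrict_lefschetzPiece (hd : IsPolarizationType Φ η d) (hη : IsRiemannForm Φ η)
    (hkq : k + q = j + 2) (hq : q ≤ j + 2) {γ : E [⋀^Fin (2 * q)]→L[ℝ] ℂ}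
    (hγ : wedgePow (ofRealForm η) q = ((q.factorial * ∏ i : Fin q, d (Fin.castLE hq i) : ℕ) : ℂ) • γ)
    (e : Fin n ≃ ι) (hn : k + (2 * q + k) = n) {B : BilinForm ℤ ↥(integralForms Φ k)}
    (hB : ∀ x y : ↥(integralForms Φ k),
      ((B x y : ℤ) : ℂ) = poincarePairing Φ e hn (x : E [⋀^Fin k]→L[ℝ] ℂ) (γ.wedge (y : E [⋀^Fin k]→L[ℝ] ℂ)))
    {s m i : ℕ} (hm : i + i = m) (h : 2 * s + m = k) {N : Submodule ℤ ↥(integralForms Φ k)}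
    (hN : ∀ u : ↥(integralForms Φ k), u ∈ N ↔
      ∃ (m' i' : ℕ) (_ : i' + i' = m') (h' : 2 * s + m' = k) (y : E [⋀^Fin m']→L[ℝ] ℂ),
        y ∈ integralHodgeClassesIn Φ m' i' ∧ y ∈ primitiveForms η m' ∧ (u : E [⋀^Fin k]→L[ℝ] ℂ) = lefschetzPow η s h' y) :
    ((((-1 : ℤ) ^ i * (orientationSign Φ e * (-1) ^ q)) • B).restrict N).PosDef := by
  rw [LinearMap.BilinForm.posDef_iff]
  intro x hx0
  have hx0' : (x : ↥(integralForms Φ k)) ≠ 0 := fun h0 ↦ hx0 (Subtype.ext h0)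
  obtain ⟨m', i', hm', h', y, hyH, hyP, hxy⟩ := (hN _).1 x.2
  obtain rfl : m = m' := by omega
  have hii : i = i' := by omega
  subst hii
  have hpos := hd.neg_one_pow_mul_apply_self_pos_of_eq_lefschetzPow hη hkq hq hγ e hn hB hm h' hyH hyP hxy hx0'
  change 0 < (((-1 : ℤ) ^ i * (orientationSign Φ e * (-1) ^ q)) • B) (x : ↥(integralForms Φ k)) (x : ↥(integralForms Φ k))
  rw [LinearMap.smul_apply, LinearMap.smul_apply, smul_eq_mul, mul_assoc]
  exact hpos

/-- **THE SIGN OF THE DISCRIMINANT OF A LEFSCHETZ PIECE: `((−1)ⁱ s')^{rk N} · disc_B(N) > 0`** for `N = Lˢ Hdgⁱ(X, ℤ)_prim ⊆ Hᵏ(X, ℤ)` and ANY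
`ℤ`-basis `b` of `N` — the piece is a definite lattice for `(−1)ⁱ s'·B_k`, so `disc_B(N) = ((−1)ⁱ s')^{rk N} · |disc_B(N)|` with `|disc_B(N)| ≥ 1`.
[cite: VoisinHodgeI2002, §6.3.2 Thm. 6.32 and (6.12) (PDF pp. 128–129)] [cite: Huybrechts2016K3, Ch. 14 §0.1, §0.2 (0.3)] [cite: Serre1973, Ch. V §1.3.2] -/
theorem IsPolarizationType.pow_mul_det_restrict_lefschetzPiece_pos (hd : IsPolarizationType Φ η d) (hη : IsRiemannForm Φ η)
    (hkq : k + q = j + 2) (hq : q ≤ j + 2) {γ : E [⋀^Fin (2 * q)]→L[ℝ] ℂ}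
    (hγ : wedgePow (ofRealForm η) q = ((q.factorial * ∏ i : Fin q, d (Fin.castLE hq i) : ℕ) : ℂ) • γ)
    (e : Fin n ≃ ι) (hn : k + (2 * q + k) = n) {B : BilinForm ℤ ↥(integralForms Φ k)}
    (hB : ∀ x y : ↥(integralForms Φ k),
      ((B x y : ℤ) : ℂ) = poincarePairing Φ e hn (x : E [⋀^Fin k]→L[ℝ] ℂ) (γ.wedge (y : E [⋀^Fin k]→L[ℝ] ℂ)))
    {s m i : ℕ} (hm : i + i = m) (h : 2 * s + m = k) {N : Submodule ℤ ↥(integralForms Φ k)}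
    (hN : ∀ u : ↥(integralForms Φ k), u ∈ N ↔
      ∃ (m' i' : ℕ) (_ : i' + i' = m') (h' : 2 * s + m' = k) (y : E [⋀^Fin m']→L[ℝ] ℂ),
        y ∈ integralHodgeClassesIn Φ m' i' ∧ y ∈ primitiveForms η m' ∧ (u : E [⋀^Fin k]→L[ℝ] ℂ) = lefschetzPow η s h' y)
    {κ : Type*} [Fintype κ] [DecidableEq κ] (b : Basis κ ℤ ↥N) :
    0 < ((-1 : ℤ) ^ i * (orientationSign Φ e * (-1) ^ q)) ^ Fintype.card κ * (LinearMap.BilinForm.toMatrix b (B.restrict N)).det := by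
  have hk : Even k := ⟨s + i, by omega⟩
  have hBs : B.IsSymm := hd.isSymm_of_eq_poincarePairing_wedge_of_even hη hk hkq hq hγ e hn hB
  have hP := hd.posDef_smul_restrict_lefschetzPiece hη hkq hq hγ e hn hB hm h hN
  have hres : (((-1 : ℤ) ^ i * (orientationSign Φ e * (-1) ^ q)) • B).restrict N =
      ((-1 : ℤ) ^ i * (orientationSign Φ e * (-1) ^ q)) • B.restrict N := rfl
  rw [hres] at hP
  exact pow_mul_det_toMatrix_pos_of_posDef_smul (B.restrict N) (hBs.restrict N) hP b

/-- **The signs of the discriminants of ALL the Lefschetz pieces of `Hdgᵖ(X, ℤ)`** (`k = p + p`, family `N : Fin (p + 1) →` sublattices of `Hᵏ(X, ℤ)`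
with `N_s = Lˢ Hdg^{p−s}(X, ℤ)_prim`, bases `b_s`): **`((−1)^{p−s} s')^{rk N_s} · disc_B(N_s) > 0` for every `s`**.
[cite: VoisinHodgeI2002, §6.3.2 Lemma 6.31, Thm. 6.32 (PDF p. 128)] [cite: Lange2023AbelianVarietiesComplex, §5.4.1 (5.22)–(5.23) (PDF p. 275)] [cite: Huybrechts2016K3, Ch. 14 §0.2 (0.3)] -/
theorem IsPolarizationType.pow_mul_det_restrict_lefschetzPieces_pos (hd : IsPolarizationType Φ η d) (hη : IsRiemannForm Φ η)
    (hkq : k + q = j + 2) (hq : q ≤ j + 2) {γ : E [⋀^Fin (2 * q)]→L[ℝ] ℂ}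
    (hγ : wedgePow (ofRealForm η) q = ((q.factorial * ∏ i : Fin q, d (Fin.castLE hq i) : ℕ) : ℂ) • γ)
    (e : Fin n ≃ ι) (hn : k + (2 * q + k) = n) {B : BilinForm ℤ ↥(integralForms Φ k)}
    (hB : ∀ x y : ↥(integralForms Φ k),
      ((B x y : ℤ) : ℂ) = poincarePairing Φ e hn (x : E [⋀^Fin k]→L[ℝ] ℂ) (γ.wedge (y : E [⋀^Fin k]→L[ℝ] ℂ)))
    (hpk : p + p = k) (N : Fin (p + 1) → Submodule ℤ ↥(integralForms Φ k))
    (hN : ∀ (s : Fin (p + 1)) (u : ↥(integralForms Φ k)), u ∈ N s ↔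
      ∃ (m i : ℕ) (_ : i + i = m) (h : 2 * (s : ℕ) + m = k) (y : E [⋀^Fin m]→L[ℝ] ℂ),
        y ∈ integralHodgeClassesIn Φ m i ∧ y ∈ primitiveForms η m ∧ (u : E [⋀^Fin k]→L[ℝ] ℂ) = lefschetzPow η (s : ℕ) h y)
    {κ : Fin (p + 1) → Type*} [∀ s, Fintype (κ s)] [∀ s, DecidableEq (κ s)] (b : ∀ s, Basis (κ s) ℤ ↥(N s)) (s : Fin (p + 1)) :
    0 < ((-1 : ℤ) ^ (p - (s : ℕ)) * (orientationSign Φ e * (-1) ^ q)) ^ Fintype.card (κ s) *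
      (LinearMap.BilinForm.toMatrix (b s) (B.restrict (N s))).det := by
  have hs := s.is_le
  exact hd.pow_mul_det_restrict_lefschetzPiece_pos hη hkq hq hγ e hn hB (m := 2 * (p - (s : ℕ))) (i := p - (s : ℕ)) (by omega)
    (by omega) (hN s) (b s)

end Pieces

/-! ## §2 The Hodge lattice `Hdgᵖ(X, ℤ) ⊆ Hᵏ(X, ℤ)`: `(s')^{rk} · (−1)^{Σ_{i ≤ p, i odd} ρ_pr^{(i)}} · disc_B Hdgᵖ(X, ℤ) > 0` -/

section HodgeLattice

variable {ι : Type*} [Fintype ι] [DecidableEq ι] {E : Type*} [NormedAddCommGroup E] [NormedSpace ℂ E]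
  {Φ : (ι → ℝ) ≃L[ℝ] E} {j n k q p : ℕ} {η : E [⋀^Fin 2]→L[ℝ] ℝ} {d : Fin (j + 2) → ℕ}

/-- **THE SIGN OF THE DISCRIMINANT OF THE INTEGRAL HODGE LATTICE: `(s')^{rk Hdgᵖ(X, ℤ)} · (−1)^{Σ_{i ≤ p, i odd} ρ_pr^{(i)}} · det (B(bₐ, b_c)) > 0`** for
every `ℤ`-basis `b` of `Hdgᵖ(X, ℤ) = Hᵏ(X, ℤ) ∩ H^{p,p}` (as the sublattice of `Hᵏ(X, ℤ)` cut out by type; `k = p + p`, `k + q = g`, `B = B_k = ⟨·, γ_q ∧ ·⟩_e`,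
`s' = sign·(−1)^q`, `ρ_pr^{(i)} = rk (Hdgⁱ(X, ℤ) ∩ P^{2i})`): the sign of `disc Λ` is `(−1)^{b⁻(Λ)}` (§0) and g46-#1 computed
`b⁻(s'·B∣Hdgᵖ(X, ℤ)) = Σ_{i ≤ p, i odd} ρ_pr^{(i)}` (Voisin's Thm. 6.32 on the lattice: the sign of `H_{2p}` on `L^{p−i} H^{i,i}_prim` is `(−1)ⁱ`).
In particular `disc_B Hdgᵖ(X, ℤ) ≠ 0` has the sign `(s')^{rk} · (−1)^{Σ_{i odd} ρ_pr^{(i)}}`; for the intersection form on the middle lattice of an abelian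
surface (`p = 1`, `q = 0`): `sign disc NS(X) = sign(e)^ρ · (−1)^{ρ − 1}`. [cite: VoisinHodgeI2002, §6.3.2 Lemma 6.31, Thm. 6.32, (6.12) (PDF pp. 128–129)]
[cite: Huybrechts2016K3, Ch. 14 §0.1, §0.2 (0.3)] [cite: Serre1973, Ch. V §1.3.2] [cite: Lange2023AbelianVarietiesComplex, §5.4.1 Thm. 5.4.2 and (5.22) (PDF p. 275); §7.3.2 (3)] -/
theorem IsPolarizationType.pow_mul_neg_one_pow_mul_det_restrict_integralHodgeClassesIn_pos (hd : IsPolarizationType Φ η d)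
    (hη : IsRiemannForm Φ η) (hpk : p + p = k) (hkq : k + q = j + 2) (hq : q ≤ j + 2)
    {γ : E [⋀^Fin (2 * q)]→L[ℝ] ℂ} (hγ : wedgePow (ofRealForm η) q = ((q.factorial * ∏ i : Fin q, d (Fin.castLE hq i) : ℕ) : ℂ) • γ)
    (e : Fin n ≃ ι) (hn : k + (2 * q + k) = n) {B : BilinForm ℤ ↥(integralForms Φ k)}
    (hB : ∀ x y : ↥(integralForms Φ k),
      ((B x y : ℤ) : ℂ) = poincarePairing Φ e hn (x : E [⋀^Fin k]→L[ℝ] ℂ) (γ.wedge (y : E [⋀^Fin k]→L[ℝ] ℂ)))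
    {κ : Type*} [Fintype κ] [DecidableEq κ]
    (b : Basis κ ℤ ↥(AddSubgroup.toIntSubmodule ((integralHodgeClassesIn Φ k p).addSubgroupOf (integralForms Φ k)))) :
    0 < (orientationSign Φ e * (-1) ^ q) ^ Fintype.card κ *
      (-1) ^ (∑ i ∈ (Finset.range (p + 1)).filter Odd, finrank ℤ ↥(integralHodgeClassesIn Φ (2 * i) i ⊓ (primitiveForms η (2 * i)).toAddSubgroup)) *
        (LinearMap.BilinForm.toMatrix b
          (B.restrict (AddSubgroup.toIntSubmodule ((integralHodgeClassesIn Φ k p).addSubgroupOf (integralForms Φ k))))).det := by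
  have hk : Even k := ⟨p, hpk.symm⟩
  have hBs : B.IsSymm := hd.isSymm_of_eq_poincarePairing_wedge_of_even hη hk hkq hq hγ e hn hB
  obtain ⟨hnd, -, -, hneg⟩ := hd.nondegenerate_finrank_sigPos_sigNeg_integralHodgeClassesIn_of_eq_poincarePairing_wedge hη hpk hkq hq hγ e hn hB
  have hc0 : orientationSign Φ e * (-1) ^ q ≠ 0 := by
    rcases orientationSign_mul_neg_one_pow_eq_or (Φ := Φ) e q with h1 | h1 <;> rw [h1] <;> norm_num
  have hdet0 : (LinearMap.BilinForm.toMatrix b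
      (B.restrict (AddSubgroup.toIntSubmodule ((integralHodgeClassesIn Φ k p).addSubgroupOf (integralForms Φ k))))).det ≠ 0 :=
    (LinearMap.BilinForm.nondegenerate_iff_det_ne_zero b).1 hnd
  exact pow_mul_neg_one_pow_mul_det_toMatrix_pos _ (hBs.restrict _) b hdet0 hc0 hneg

end HodgeLattice

/-! ## §3 The Hodge lattice `Hdgᵖ(X, ℤ) = integralHodgeClassesIn Φ k p` with the pulled-back form: the sign through the Lefschetz decomposition -/

section Comp

variable {ι : Type*} [Fintype ι] [DecidableEq ι] {E : Type*} [NormedAddCommGroup E] [NormedSpace ℂ E]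
  {Φ : (ι → ℝ) ≃L[ℝ] E} {j n k q p : ℕ} {η : E [⋀^Fin 2]→L[ℝ] ℝ} {d : Fin (j + 2) → ℕ}

/-- **`(∏_s ((−1)^{p−s} s')^{rk N_s}) · disc Hdgᵖ(X, ℤ) > 0` through the integral Lefschetz decomposition**: for bases `b_s` of the pieces
`N_s = Lˢ Hdg^{p−s}(X, ℤ)_prim` and a `ℤ`-basis `b_Λ` of `Hdgᵖ(X, ℤ) = integralHodgeClassesIn Φ k p` indexed like the assembled basis, g47-#5's
`∏_s disc_B(N_s) = [Hdgᵖ(X, ℤ) : ⊕_s N_s]² · disc Hdgᵖ(X, ℤ)` (Huybrechts (0.1)) and the signs of the pieces (§1) give the sign of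
`disc Hdgᵖ(X, ℤ) = det (B(ι b_Λ a, ι b_Λ c))` (the index being positive, g47-#4) — a second derivation of §2, from the Lefschetz decomposition instead of
the signature. [cite: Lange2023AbelianVarietiesComplex, §5.4.1 Thm. 5.4.2 and (5.22)–(5.23) (PDF p. 275); §7.3.2 (3)] [cite: Huybrechts2016K3, Ch. 14 §0.1 (0.1), §0.2 (0.3)]
[cite: VoisinHodgeI2002, §6.3.2 Lemma 6.31, Thm. 6.32 (PDF p. 128)] [cite: Kitaoka1993, Ch. 5 §5.3 Prop. 5.3.3 (proof)] -/
theorem IsPolarizationType.prod_pow_mul_det_comp_inclusion_pos_of_basis_sigma (hd : IsPolarizationType Φ η d) (hη : IsRiemannForm Φ η)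
    (hkq : k + q = j + 2) (hq : q ≤ j + 2) {γ : E [⋀^Fin (2 * q)]→L[ℝ] ℂ}
    (hγ : wedgePow (ofRealForm η) q = ((q.factorial * ∏ i : Fin q, d (Fin.castLE hq i) : ℕ) : ℂ) • γ)
    (e : Fin n ≃ ι) (hn : k + (2 * q + k) = n) {B : BilinForm ℤ ↥(integralForms Φ k)}
    (hB : ∀ x y : ↥(integralForms Φ k),
      ((B x y : ℤ) : ℂ) = poincarePairing Φ e hn (x : E [⋀^Fin k]→L[ℝ] ℂ) (γ.wedge (y : E [⋀^Fin k]→L[ℝ] ℂ)))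
    (hpk : p + p = k) (N : Fin (p + 1) → Submodule ℤ ↥(integralForms Φ k))
    (hN : ∀ (s : Fin (p + 1)) (u : ↥(integralForms Φ k)), u ∈ N s ↔
      ∃ (m i : ℕ) (_ : i + i = m) (h : 2 * (s : ℕ) + m = k) (y : E [⋀^Fin m]→L[ℝ] ℂ),
        y ∈ integralHodgeClassesIn Φ m i ∧ y ∈ primitiveForms η m ∧ (u : E [⋀^Fin k]→L[ℝ] ℂ) = lefschetzPow η (s : ℕ) h y)
    {κ : Fin (p + 1) → Type*} [∀ s, Fintype (κ s)] [∀ s, DecidableEq (κ s)] (b : ∀ s, Basis (κ s) ℤ ↥(N s))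
    (bΛ : Basis (Σ s, κ s) ℤ ↥(integralHodgeClassesIn Φ k p)) :
    0 < (∏ s : Fin (p + 1), ((-1 : ℤ) ^ (p - (s : ℕ)) * (orientationSign Φ e * (-1) ^ q)) ^ Fintype.card (κ s)) *
      (LinearMap.BilinForm.toMatrix bΛ (B.comp (AddSubgroup.inclusion (integralHodgeClassesIn_le_integralForms Φ k p)).toIntLinearMap
        (AddSubgroup.inclusion (integralHodgeClassesIn_le_integralForms Φ k p)).toIntLinearMap)).det := by
  have hk : k ≤ j + 2 := by omega
  have hprod := hd.prod_det_lefschetzPieces_eq_index_sq_mul_det hη hkq hq hγ e hn hB hpk N hN b bΛ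
  have hI := hd.index_comap_iSup_lefschetzPieces_pos hη hpk hk N hN
  -- the product of the signed piece discriminants is positive
  have hpieces : 0 < ∏ s : Fin (p + 1), (((-1 : ℤ) ^ (p - (s : ℕ)) * (orientationSign Φ e * (-1) ^ q)) ^ Fintype.card (κ s) *
      (LinearMap.BilinForm.toMatrix (b s) (B.restrict (N s))).det) :=
    Finset.prod_pos fun s _ ↦ hd.pow_mul_det_restrict_lefschetzPieces_pos hη hkq hq hγ e hn hB hpk N hN b s
  rw [Finset.prod_mul_distrib, hprod, mul_left_comm] at hpieces
  have hI2 : (0 : ℤ) < ((((⨆ s, N s).comap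
      (AddSubgroup.inclusion (integralHodgeClassesIn_le_integralForms Φ k p)).toIntLinearMap).toAddSubgroup.index : ℕ) : ℤ) ^ 2 :=
    pow_pos (Int.natCast_pos.2 hI) 2
  exact (mul_pos_iff_of_pos_left hI2).1 hpieces

/-- `∏_s (εₛ c)^{nₛ} = c^{Σ nₛ} · ∏_s εₛ^{nₛ}` with `εₛ = (−1)^{p−s}`: collecting the signs of the pieces. [folklore] -/
private theorem prod_neg_one_pow_mul_pow_eq₉₁ (c : ℤ) {σ : Type*} [Fintype σ] (f : σ → ℕ) (r : σ → ℕ) :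
    ∏ s, ((-1 : ℤ) ^ f s * c) ^ r s = c ^ (∑ s, r s) * (-1) ^ (∑ s, f s * r s) := by
  simp_rw [mul_pow, ← pow_mul]
  rw [Finset.prod_mul_distrib, Finset.prod_pow_eq_pow_sum, Finset.prod_pow_eq_pow_sum, mul_comm]

/-- **THE SIGN OF `disc Hdgᵖ(X, ℤ)` IN EVERY `ℤ`-BASIS, through the Lefschetz decomposition: `(s')^{rk Hdgᵖ(X, ℤ)} · (−1)^{Σ_s (p−s)·rk N_s} · disc Hdgᵖ(X, ℤ) > 0`**
for every `ℤ`-basis `b_Λ` of `Hdgᵖ(X, ℤ) = integralHodgeClassesIn Φ k p` (`k = p + p`, the form pulled back along `Hdgᵖ(X, ℤ) ↪ Hᵏ(X, ℤ)`), `N_s` the Lefschetz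
pieces (`rk N_s = ρ_pr^{(p−s)}`, g47-#4): bases of the pieces exist (sublattices of the free lattice `Hᵏ(X, ℤ)`), a `Σ`-indexed basis of `Hdgᵖ(X, ℤ)` exists
(g47-#5), the previous theorem applies, and the Gram determinant does not depend on the basis (§0).
[cite: Lange2023AbelianVarietiesComplex, §5.4.1 Thm. 5.4.2 and (5.22)–(5.23) (PDF p. 275); §7.3.2 (3)] [cite: Huybrechts2016K3, Ch. 14 §0.1 (0.1), §0.2 (0.3)]
[cite: VoisinHodgeI2002, §6.3.2 Lemma 6.31, Thm. 6.32 (PDF p. 128)] -/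
theorem IsPolarizationType.pow_mul_neg_one_pow_mul_det_comp_inclusion_pos (hd : IsPolarizationType Φ η d) (hη : IsRiemannForm Φ η)
    (hkq : k + q = j + 2) (hq : q ≤ j + 2) {γ : E [⋀^Fin (2 * q)]→L[ℝ] ℂ}
    (hγ : wedgePow (ofRealForm η) q = ((q.factorial * ∏ i : Fin q, d (Fin.castLE hq i) : ℕ) : ℂ) • γ)
    (e : Fin n ≃ ι) (hn : k + (2 * q + k) = n) {B : BilinForm ℤ ↥(integralForms Φ k)}
    (hB : ∀ x y : ↥(integralForms Φ k),
      ((B x y : ℤ) : ℂ) = poincarePairing Φ e hn (x : E [⋀^Fin k]→L[ℝ] ℂ) (γ.wedge (y : E [⋀^Fin k]→L[ℝ] ℂ)))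
    (hpk : p + p = k) (N : Fin (p + 1) → Submodule ℤ ↥(integralForms Φ k))
    (hN : ∀ (s : Fin (p + 1)) (u : ↥(integralForms Φ k)), u ∈ N s ↔
      ∃ (m i : ℕ) (_ : i + i = m) (h : 2 * (s : ℕ) + m = k) (y : E [⋀^Fin m]→L[ℝ] ℂ),
        y ∈ integralHodgeClassesIn Φ m i ∧ y ∈ primitiveForms η m ∧ (u : E [⋀^Fin k]→L[ℝ] ℂ) = lefschetzPow η (s : ℕ) h y)
    {κ' : Type*} [Fintype κ'] [DecidableEq κ'] (bΛ : Basis κ' ℤ ↥(integralHodgeClassesIn Φ k p)) :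
    0 < (orientationSign Φ e * (-1) ^ q) ^ Fintype.card κ' * (-1) ^ (∑ s : Fin (p + 1), (p - (s : ℕ)) * finrank ℤ ↥(N s)) *
      (LinearMap.BilinForm.toMatrix bΛ (B.comp (AddSubgroup.inclusion (integralHodgeClassesIn_le_integralForms Φ k p)).toIntLinearMap
        (AddSubgroup.inclusion (integralHodgeClassesIn_le_integralForms Φ k p)).toIntLinearMap)).det := by
  classical
  have hk : k ≤ j + 2 := by omega
  letI : LinearOrder ι := LinearOrder.lift' (Fintype.equivFin ι) (Fintype.equivFin ι).injective
  let bK : Basis {w : Fin k → ι // StrictMono w} ℤ ↥(integralForms Φ k) := intLatMonomialBasis Φ k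
  -- bases of the pieces
  have hb : ∀ s : Fin (p + 1), ∃ r : ℕ, Nonempty (Basis (Fin r) ℤ ↥(N s)) := fun s ↦ by
    obtain ⟨r, b⟩ := Submodule.basisOfPid bK (N s)
    exact ⟨r, ⟨b⟩⟩
  choose r hr using hb
  let b : ∀ s : Fin (p + 1), Basis (Fin (r s)) ℤ ↥(N s) := fun s ↦ (hr s).some
  -- a `Σ`-indexed basis of `Hdgᵖ(X, ℤ)`
  obtain ⟨bS⟩ := hd.exists_basis_integralHodgeClassesIn_sigma hη hpk hk N hN b
  have hpos := hd.prod_pow_mul_det_comp_inclusion_pos_of_basis_sigma hη hkq hq hγ e hn hB hpk N hN b bS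
  rw [prod_neg_one_pow_mul_pow_eq₉₁ (orientationSign Φ e * (-1) ^ q) (fun s : Fin (p + 1) ↦ p - (s : ℕ))
    (fun s : Fin (p + 1) ↦ Fintype.card (Fin (r s))), det_toMatrix_eq_det_toMatrix _ bS bΛ] at hpos
  have hcard : ∑ s : Fin (p + 1), Fintype.card (Fin (r s)) = Fintype.card κ' := by
    haveI := moduleFinite_integralHodgeClassesIn Φ k p
    rw [← Fintype.card_sigma, ← finrank_eq_card_basis bS, finrank_eq_card_basis bΛ]
  have hrk : ∀ s : Fin (p + 1), Fintype.card (Fin (r s)) = finrank ℤ ↥(N s) := fun s ↦ (finrank_eq_card_basis (b s)).symm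
  rw [hcard] at hpos
  simp_rw [hrk] at hpos
  exact hpos

end Comp

/-! ## §4 The two exponents agree: `Σ_s (p − s)·rk N_s ≡ Σ_{i ≤ p, i odd} ρ_pr^{(i)} (mod 2)` -/

section Parity

/-- **`(−1)^{Σ_{i ≤ p} i·ρᵢ} = (−1)^{Σ_{i ≤ p, i odd} ρᵢ}`**: the even `i` contribute squares. [folklore] -/
private theorem neg_one_pow_sum_range_mul_eq₉₁ (ρ : ℕ → ℕ) (p : ℕ) :
    (-1 : ℤ) ^ (∑ i ∈ Finset.range (p + 1), i * ρ i) = (-1) ^ (∑ i ∈ (Finset.range (p + 1)).filter Odd, ρ i) := by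
  rw [← Finset.prod_pow_eq_pow_sum, ← Finset.prod_pow_eq_pow_sum, Finset.prod_filter]
  refine Finset.prod_congr rfl fun i _ ↦ ?_
  split_ifs with hi
  · rw [pow_mul, hi.neg_one_pow]
  · rw [pow_mul, (Nat.not_odd_iff_even.1 hi).neg_one_pow, one_pow]

/-- `(−1)^{Σ_s (p − s)·ρ_{p−s}} = (−1)^{Σ_{i ≤ p, i odd} ρᵢ}` for a `Fin (p + 1)`-indexed family re-indexed by `i = p − s`. [folklore] -/
private theorem neg_one_pow_sum_mul_eq_neg_one_pow_sum_filter_odd₉₁ (ρ : ℕ → ℕ) (p : ℕ) :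
    (-1 : ℤ) ^ (∑ s : Fin (p + 1), (p - (s : ℕ)) * ρ (p - (s : ℕ))) = (-1) ^ (∑ i ∈ (Finset.range (p + 1)).filter Odd, ρ i) := by
  rw [← neg_one_pow_sum_range_mul_eq₉₁ ρ p, Finset.sum_range]
  congr 1
  refine Fintype.sum_equiv Fin.revPerm _ _ fun s ↦ ?_
  have hs : p - (s : ℕ) = ((Fin.revPerm s : Fin (p + 1)) : ℕ) := by
    rw [Fin.revPerm_apply, Fin.val_rev]
    omega
  rw [hs]

variable {ι : Type*} [Fintype ι] [DecidableEq ι] {E : Type*} [NormedAddCommGroup E] [NormedSpace ℂ E]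
  {Φ : (ι → ℝ) ≃L[ℝ] E} {j n k q p : ℕ} {η : E [⋀^Fin 2]→L[ℝ] ℝ} {d : Fin (j + 2) → ℕ}

omit [DecidableEq ι] in
/-- **`(−1)^{Σ_s (p−s)·rk N_s} = (−1)^{Σ_{i ≤ p, i odd} ρ_pr^{(i)}}`** for the Lefschetz pieces `N_s = Lˢ Hdg^{p−s}(X, ℤ)_prim` (`rk N_s = ρ_pr^{(p−s)}`, g47-#4): the
sign exponent of §3 (Lefschetz decomposition) is the sign exponent of §2 (`b⁻` of g46-#1). [cite: Lange2023AbelianVarietiesComplex, §5.4.1 (5.22) (PDF p. 275); §7.3.2 (3)] [cite: VoisinHodgeI2002, §6.3.2 Thm. 6.32 (PDF p. 128)] -/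
theorem IsPolarizationType.neg_one_pow_sum_lefschetzPieces_eq (hd : IsPolarizationType Φ η d) (hη : IsRiemannForm Φ η)
    (hpk : p + p = k) (hk : k ≤ j + 2) (N : Fin (p + 1) → Submodule ℤ ↥(integralForms Φ k))
    (hN : ∀ (s : Fin (p + 1)) (u : ↥(integralForms Φ k)), u ∈ N s ↔
      ∃ (m i : ℕ) (_ : i + i = m) (h : 2 * (s : ℕ) + m = k) (y : E [⋀^Fin m]→L[ℝ] ℂ),
        y ∈ integralHodgeClassesIn Φ m i ∧ y ∈ primitiveForms η m ∧ (u : E [⋀^Fin k]→L[ℝ] ℂ) = lefschetzPow η (s : ℕ) h y) :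
    (-1 : ℤ) ^ (∑ s : Fin (p + 1), (p - (s : ℕ)) * finrank ℤ ↥(N s)) =
      (-1) ^ (∑ i ∈ (Finset.range (p + 1)).filter Odd, finrank ℤ ↥(integralHodgeClassesIn Φ (2 * i) i ⊓ (primitiveForms η (2 * i)).toAddSubgroup)) := by
  rw [← neg_one_pow_sum_mul_eq_neg_one_pow_sum_filter_odd₉₁
    (fun i ↦ finrank ℤ ↥(integralHodgeClassesIn Φ (2 * i) i ⊓ (primitiveForms η (2 * i)).toAddSubgroup)) p]
  congr 1
  exact Finset.sum_congr rfl fun s _ ↦ by rw [hd.finrank_lefschetzPiece_eq_of_family hη hpk hk N hN s]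

/-- **THE SIGN OF `disc Hdgᵖ(X, ℤ)` (pulled-back form, every `ℤ`-basis) IN CLOSED FORM: `(s')^{rk Hdgᵖ(X, ℤ)} · (−1)^{Σ_{i ≤ p, i odd} ρ_pr^{(i)}} · disc Hdgᵖ(X, ℤ) > 0`** —
§3 with the exponent rewritten by §4; the same sign as §2's (g46-#1's `b⁻`), obtained through the integral Lefschetz decomposition (the pieces exist by
g47-#3). [cite: VoisinHodgeI2002, §6.3.2 Lemma 6.31, Thm. 6.32, (6.12) (PDF pp. 128–129)] [cite: Lange2023AbelianVarietiesComplex, §5.4.1 Thm. 5.4.2 and (5.22)–(5.23) (PDF p. 275); §7.3.2 (3)]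
[cite: Huybrechts2016K3, Ch. 14 §0.1 (0.1), §0.2 (0.3)] [cite: Serre1973, Ch. V §1.3.2] -/
theorem IsPolarizationType.pow_mul_neg_one_pow_sum_filter_odd_mul_det_comp_inclusion_pos (hd : IsPolarizationType Φ η d)
    (hη : IsRiemannForm Φ η) (hkq : k + q = j + 2) (hq : q ≤ j + 2) {γ : E [⋀^Fin (2 * q)]→L[ℝ] ℂ}
    (hγ : wedgePow (ofRealForm η) q = ((q.factorial * ∏ i : Fin q, d (Fin.castLE hq i) : ℕ) : ℂ) • γ)
    (e : Fin n ≃ ι) (hn : k + (2 * q + k) = n) {B : BilinForm ℤ ↥(integralForms Φ k)}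
    (hB : ∀ x y : ↥(integralForms Φ k),
      ((B x y : ℤ) : ℂ) = poincarePairing Φ e hn (x : E [⋀^Fin k]→L[ℝ] ℂ) (γ.wedge (y : E [⋀^Fin k]→L[ℝ] ℂ)))
    (hpk : p + p = k) {κ' : Type*} [Fintype κ'] [DecidableEq κ'] (bΛ : Basis κ' ℤ ↥(integralHodgeClassesIn Φ k p)) :
    0 < (orientationSign Φ e * (-1) ^ q) ^ Fintype.card κ' *
      (-1) ^ (∑ i ∈ (Finset.range (p + 1)).filter Odd, finrank ℤ ↥(integralHodgeClassesIn Φ (2 * i) i ⊓ (primitiveForms η (2 * i)).toAddSubgroup)) *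
      (LinearMap.BilinForm.toMatrix bΛ (B.comp (AddSubgroup.inclusion (integralHodgeClassesIn_le_integralForms Φ k p)).toIntLinearMap
        (AddSubgroup.inclusion (integralHodgeClassesIn_le_integralForms Φ k p)).toIntLinearMap)).det := by
  have hk : k ≤ j + 2 := by omega
  obtain ⟨N, hN⟩ := exists_family_mem_iff_exists_eq_lefschetzPow Φ η hpk
  rw [← hd.neg_one_pow_sum_lefschetzPieces_eq hη hpk hk N hN]
  exact hd.pow_mul_neg_one_pow_mul_det_comp_inclusion_pos hη hkq hq hγ e hn hB hpk N hN bΛ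

end Parity

end Literature.Geometry.Kaehler.ComplexTorus

end
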